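import Mathlib.NumberTheory.LSeries.Basic
import Mathlib.Analysis.Calculus.Deriv.Star
import Mathlib.Analysis.Analytic.Uniqueness
import Mathlib.Analysis.Complex.CauchyIntegral
import Mathlib.Analysis.SpecialFunctions.Pow.Complex
import Mathlib.Analysis.Complex.Convex
import HarnessLib

/-!
# Reflection symmetry `g(s̄) = conj g(s)` of continuations of Dirichlet series with real coefficients

Topic `Literature/NumberTheory/LFunctions`. Everything here is PROVED (theorems only).

**Schwarz reflection for `L`-series (folklore).** If `a : ℕ → ℂ` has real values (`conj a(n) = a(n)`) then
`L(a, s̄) = conj L(a, s)` wherever the series is used (`LSeries_conj`, an identity of `tsum`s, no convergence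
needed). Consequently a holomorphic continuation `g` of `L(a, ·)` from a right half-plane `Re s > x₀` to an
open preconnected `U ⊇ {Re s > x₀}` stable under conjugation satisfies `g(s̄) = conj g(s)` on `U`
(`continuation_conj`: `s ↦ conj g(s̄)` is holomorphic on `U`, Mathlib `differentiableAt_conj_conj_iff`, and
agrees with `g` on the half-plane, so everywhere by the identity theorem), and in particular **`g` is real on
`U ∩ ℝ`** (`continuation_ofReal_im_eq_zero`). General form: a symmetry `g(s̄) = conj g(s)` known on the
half-plane propagates to `U` (`conj_symm_of_halfPlane`), whence the case `Z(s) = (s − 1)L(a, s)` of an entire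
`Z` (`entire_sub_one_mul_ofReal_im_eq_zero`; model `(s − 1)ζ_K(s)`).

**Purpose.** The reality fields `Z_im`, `L_im` of the abstract Siegel theorem (`SiegelFamilyData`,
`SiegelTheoremAbstract.lean`) for `Z = (s − 1)ζ_K(s)` (`dedekindZeta₁`, entire) and for Hecke's entire
continuations of the `L`-series of REAL ray class characters (`exists_differentiable_eq_rayClassLSeries`,
`RayClassPartialZetaResidue.lean`), both of which are continuations of Dirichlet series with real coefficients.

## References

* E. C. Titchmarsh, *The Theory of Functions*, 2nd ed., OUP 1939, §4.5 (Schwarz's reflection principle).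
  [folklore]
* H. L. Montgomery, R. C. Vaughan, *Multiplicative Number Theory I*, CUP 2007, §10.1 (p. 328: "`ζ(s̄) = \\overline{ζ(s)}`").
  [cite: MontgomeryVaughan2007, §10.1]

## Mathlib / tree search

Mathlib: `differentiableAt_conj_conj_iff` (`Analysis/Calculus/Deriv/Star`), `Complex.cpow_conj`,
`Complex.natCast_arg`, `tsum_star`, `AnalyticOnNhd.eqOn_of_preconnected_of_eventuallyEq`,
`DifferentiableOn.analyticOnNhd`; no `LSeries_conj` (`lean search 'LSeries.*conj|conj.*LSeries' --decl`: nothing).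
Tree: `differentiableOn_conj_conj` (`Analysis/Complex/SymmetricRiemannMap.lean`, not imported here).
-/

noncomputable section

open Complex Filter Topology Set
open scoped ComplexConjugate

namespace Literature.NumberTheory.LFunctions

/-- `n^{s̄} = conj (n^s)` for `n ∈ ℕ`. [folklore] -/
theorem natCast_cpow_conj (n : ℕ) (s : ℂ) : (n : ℂ) ^ conj s = conj ((n : ℂ) ^ s) := by
  have harg : ((n : ℂ)).arg ≠ Real.pi := by
    rw [Complex.natCast_arg]; exact Real.pi_pos.ne
  rw [Complex.cpow_conj _ _ harg, Complex.conj_natCast]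

/-- The terms of an `L`-series with real coefficients: `term a s̄ n = conj (term a s n)`. [folklore] -/
theorem LSeries_term_conj {a : ℕ → ℂ} (ha : ∀ n, conj (a n) = a n) (s : ℂ) (n : ℕ) :
    LSeries.term a (conj s) n = conj (LSeries.term a s n) := by
  rcases Nat.eq_zero_or_pos n with rfl | hn
  · simp [LSeries.term_zero]
  · rw [LSeries.term_of_ne_zero hn.ne', LSeries.term_of_ne_zero hn.ne', map_div₀, ha, natCast_cpow_conj]

/-- **`L(a, s̄) = conj L(a, s)`** for real coefficients (an identity of unconditional sums). [folklore] -/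
theorem LSeries_conj {a : ℕ → ℂ} (ha : ∀ n, conj (a n) = a n) (s : ℂ) :
    LSeries a (conj s) = conj (LSeries a s) := by
  rw [LSeries, LSeries]
  have h : (starRingEnd ℂ) (∑' n, LSeries.term a s n) = ∑' n, (starRingEnd ℂ) (LSeries.term a s n) :=
    tsum_star
  rw [h]
  exact tsum_congr fun n => LSeries_term_conj ha s n

/-- `L(a, σ)` is real for real `σ` and real coefficients. [folklore] -/
theorem LSeries_ofReal_im_eq_zero {a : ℕ → ℂ} (ha : ∀ n, conj (a n) = a n) (σ : ℝ) :
    (LSeries a σ).im = 0 := by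
  have h := LSeries_conj ha (σ : ℂ)
  rw [Complex.conj_ofReal] at h
  exact Complex.conj_eq_iff_im.mp h.symm

/-- **Reflection symmetry of a continuation.** Let `a` have real coefficients, `U` be open, preconnected,
stable under conjugation and containing the half-plane `Re s > x₀`, and let `g` be holomorphic on `U` with
`g = L(a, ·)` on `Re s > x₀`. Then `g(s̄) = conj g(s)` for all `s ∈ U`. [folklore] -/
theorem continuation_conj {a : ℕ → ℂ} (ha : ∀ n, conj (a n) = a n) {U : Set ℂ} (hU : IsOpen U)
    (hUc : IsPreconnected U) (hsymm : ∀ s ∈ U, conj s ∈ U) {x₀ : ℝ} (hsub : {s : ℂ | x₀ < s.re} ⊆ U)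
    {g : ℂ → ℂ} (hg : DifferentiableOn ℂ g U) (heq : ∀ s : ℂ, x₀ < s.re → g s = LSeries a s)
    {s : ℂ} (hs : s ∈ U) : g (conj s) = conj (g s) := by
  -- the reflected function
  set g' : ℂ → ℂ := conj ∘ g ∘ conj with hg'
  have hg'd : DifferentiableOn ℂ g' U := by
    intro z hz
    have hz' : conj z ∈ U := hsymm z hz
    have hd : DifferentiableAt ℂ g (conj z) := hg.differentiableAt (hU.mem_nhds hz')
    exact (differentiableAt_conj_conj_iff.mpr hd).differentiableWithinAt
  have hgan : AnalyticOnNhd ℂ g U := hg.analyticOnNhd hU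
  have hg'an : AnalyticOnNhd ℂ g' U := hg'd.analyticOnNhd hU
  -- agreement on the half-plane
  have hhalf : IsOpen {s : ℂ | x₀ < s.re} := isOpen_lt continuous_const Complex.continuous_re
  set z₀ : ℂ := ((x₀ + 1 : ℝ) : ℂ) with hz₀
  have hz₀mem : z₀ ∈ {s : ℂ | x₀ < s.re} := by
    simp only [Set.mem_setOf_eq, hz₀, Complex.ofReal_re]; linarith
  have hev : g =ᶠ[𝓝 z₀] g' := by
    filter_upwards [hhalf.mem_nhds hz₀mem] with z hz
    have hz' : x₀ < (conj z).re := by rwa [Complex.conj_re]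
    simp only [hg', Function.comp_apply]
    rw [heq z hz, heq (conj z) hz', LSeries_conj ha, Complex.conj_conj]
  have hEq := hgan.eqOn_of_preconnected_of_eventuallyEq hg'an hUc (hsub hz₀mem) hev
  -- evaluate at `conj s`
  have h := hEq (hsymm s hs)
  simp only [hg', Function.comp_apply, Complex.conj_conj] at h
  exact h

/-- **A continuation of a real-coefficient `L`-series is real on the real points of `U`.** [folklore] -/
theorem continuation_ofReal_im_eq_zero {a : ℕ → ℂ} (ha : ∀ n, conj (a n) = a n) {U : Set ℂ} (hU : IsOpen U)
    (hUc : IsPreconnected U) (hsymm : ∀ s ∈ U, conj s ∈ U) {x₀ : ℝ} (hsub : {s : ℂ | x₀ < s.re} ⊆ U)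
    {g : ℂ → ℂ} (hg : DifferentiableOn ℂ g U) (heq : ∀ s : ℂ, x₀ < s.re → g s = LSeries a s)
    {σ : ℝ} (hσ : (σ : ℂ) ∈ U) : (g σ).im = 0 := by
  have h := continuation_conj ha hU hUc hsymm hsub hg heq hσ
  rw [Complex.conj_ofReal] at h
  exact Complex.conj_eq_iff_im.mp h.symm

/-- **Entire case**: an entire continuation `g` of a real-coefficient `L`-series satisfies `g(s̄) = conj g(s)`
everywhere and is real on the real axis. [folklore] -/
theorem entire_continuation_conj {a : ℕ → ℂ} (ha : ∀ n, conj (a n) = a n) {x₀ : ℝ} {g : ℂ → ℂ}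
    (hg : Differentiable ℂ g) (heq : ∀ s : ℂ, x₀ < s.re → g s = LSeries a s) (s : ℂ) :
    g (conj s) = conj (g s) :=
  continuation_conj ha isOpen_univ isPreconnected_univ (fun _ _ => Set.mem_univ _) (Set.subset_univ _)
    hg.differentiableOn heq (Set.mem_univ s)

/-- Entire case, real points. [folklore] -/
theorem entire_continuation_ofReal_im_eq_zero {a : ℕ → ℂ} (ha : ∀ n, conj (a n) = a n) {x₀ : ℝ} {g : ℂ → ℂ}
    (hg : Differentiable ℂ g) (heq : ∀ s : ℂ, x₀ < s.re → g s = LSeries a s) (σ : ℝ) : (g σ).im = 0 :=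
  continuation_ofReal_im_eq_zero ha isOpen_univ isPreconnected_univ (fun _ _ => Set.mem_univ _)
    (Set.subset_univ _) hg.differentiableOn heq (Set.mem_univ _)

/-- **Half-plane case**: `U = {Re s > y}` (open, convex, conjugation-stable). [folklore] -/
theorem halfPlane_continuation_ofReal_im_eq_zero {a : ℕ → ℂ} (ha : ∀ n, conj (a n) = a n) {x₀ y : ℝ}
    (hyx : y ≤ x₀) {g : ℂ → ℂ} (hg : DifferentiableOn ℂ g {s : ℂ | y < s.re})
    (heq : ∀ s : ℂ, x₀ < s.re → g s = LSeries a s) {σ : ℝ} (hσ : y < σ) : (g σ).im = 0 := by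
  have hU : IsOpen {s : ℂ | y < s.re} := isOpen_lt continuous_const Complex.continuous_re
  have hUc : IsPreconnected {s : ℂ | y < s.re} :=
    (convex_halfSpace_re_gt y).isPreconnected
  refine continuation_ofReal_im_eq_zero ha hU hUc (fun s hs => ?_) (fun s hs => ?_) hg heq ?_
  · simpa [Complex.conj_re] using hs
  · exact lt_of_le_of_lt hyx hs
  · simpa using hσ

/-! ### General form: a symmetry on the half-plane propagates to `U` -/

/-- **Reflection symmetry propagates** (general form): if `g` is holomorphic on an open preconnected
conjugation-stable `U ⊇ {Re s > x₀}` and `g(s̄) = conj g(s)` holds on the half-plane `Re s > x₀` (e.g.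
`g = (s − 1)·L(a, s)` there, with real `a`), then it holds on all of `U`. [folklore] -/
theorem conj_symm_of_halfPlane {U : Set ℂ} (hU : IsOpen U) (hUc : IsPreconnected U)
    (hsymm : ∀ s ∈ U, conj s ∈ U) {x₀ : ℝ} (hsub : {s : ℂ | x₀ < s.re} ⊆ U) {g : ℂ → ℂ}
    (hg : DifferentiableOn ℂ g U) (heq : ∀ s : ℂ, x₀ < s.re → g (conj s) = conj (g s))
    {s : ℂ} (hs : s ∈ U) : g (conj s) = conj (g s) := by
  set g' : ℂ → ℂ := conj ∘ g ∘ conj with hg'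
  have hg'd : DifferentiableOn ℂ g' U := by
    intro z hz
    have hz' : conj z ∈ U := hsymm z hz
    have hd : DifferentiableAt ℂ g (conj z) := hg.differentiableAt (hU.mem_nhds hz')
    exact (differentiableAt_conj_conj_iff.mpr hd).differentiableWithinAt
  have hgan : AnalyticOnNhd ℂ g U := hg.analyticOnNhd hU
  have hg'an : AnalyticOnNhd ℂ g' U := hg'd.analyticOnNhd hU
  have hhalf : IsOpen {s : ℂ | x₀ < s.re} := isOpen_lt continuous_const Complex.continuous_re
  set z₀ : ℂ := ((x₀ + 1 : ℝ) : ℂ) with hz₀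
  have hz₀mem : z₀ ∈ {s : ℂ | x₀ < s.re} := by
    simp only [Set.mem_setOf_eq, hz₀, Complex.ofReal_re]; linarith
  have hev : g =ᶠ[𝓝 z₀] g' := by
    filter_upwards [hhalf.mem_nhds hz₀mem] with z hz
    simp only [hg', Function.comp_apply]
    rw [heq z hz, Complex.conj_conj]
  have hEq := hgan.eqOn_of_preconnected_of_eventuallyEq hg'an hUc (hsub hz₀mem) hev
  have h := hEq (hsymm s hs)
  simp only [hg', Function.comp_apply, Complex.conj_conj] at h
  exact h

/-- General form, real points: `g` is real on `U ∩ ℝ`. [folklore] -/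
theorem ofReal_im_eq_zero_of_halfPlane_conj_symm {U : Set ℂ} (hU : IsOpen U) (hUc : IsPreconnected U)
    (hsymm : ∀ s ∈ U, conj s ∈ U) {x₀ : ℝ} (hsub : {s : ℂ | x₀ < s.re} ⊆ U) {g : ℂ → ℂ}
    (hg : DifferentiableOn ℂ g U) (heq : ∀ s : ℂ, x₀ < s.re → g (conj s) = conj (g s))
    {σ : ℝ} (hσ : (σ : ℂ) ∈ U) : (g σ).im = 0 := by
  have h := conj_symm_of_halfPlane hU hUc hsymm hsub hg heq hσ
  rw [Complex.conj_ofReal] at h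
  exact Complex.conj_eq_iff_im.mp h.symm

/-- **`(s − 1)L(a, s)`-type continuations**: an ENTIRE `Z` with `Z(s) = (s − 1) L(a, s)` for `Re s > x₀`
(`a` real; model: `Z = (s − 1)ζ_K(s)`, `dedekindZeta₁`) satisfies `Z(s̄) = conj Z(s)` and is real on `ℝ`. [folklore] -/
theorem entire_sub_one_mul_ofReal_im_eq_zero {a : ℕ → ℂ} (ha : ∀ n, conj (a n) = a n) {x₀ : ℝ} {Z : ℂ → ℂ}
    (hZ : Differentiable ℂ Z) (heq : ∀ s : ℂ, x₀ < s.re → Z s = (s - 1) * LSeries a s) (σ : ℝ) :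
    (Z σ).im = 0 := by
  refine ofReal_im_eq_zero_of_halfPlane_conj_symm isOpen_univ isPreconnected_univ (fun _ _ => Set.mem_univ _)
    (Set.subset_univ {s : ℂ | x₀ < s.re}) hZ.differentiableOn (fun s hs => ?_) (Set.mem_univ _)
  have hs' : x₀ < (conj s).re := by rwa [Complex.conj_re]
  rw [heq s hs, heq (conj s) hs', LSeries_conj ha, map_mul, map_sub, map_one]

end Literature.NumberTheory.LFunctions

end
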